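import Summits.ABC.ABC.Theorems.CongruentialReceptacleTameLocalReceptacleFamiliesDefs

/-!
# Crux `TameLocalReceptacle` (stmt-ABC-14354), line `grh-friable-cell-resolution`:
# key-cell quantities of the explicit families as pair counts

Helper file of the analytic engine of the checked skeleton
`Cruxes/TameLocalReceptacle/Lines/grh_friable_cell_resolution.lean` (lead `prover-line-stmt-ABC-14354-a1-0`; registered
stub `stub_familyPairsA`, wave 5 "FamilyCounts").  The explicit families of `…FamiliesDefs.lean` are images of PAIR SETS:
`FAfam N M y` of the pairs `(m, b)` under `(m, b) ↦ (2^N m, b, 2^N m + b)`, `FCfam N M y` of the pairs `(m, a)` under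
`(m, a) ↦ (a, 2^N m − a, 2^N m)`, and `FBfam N M y` is the swap image `(a, b, c) ↦ (b, a, c)` of `FAfam N M y`.  The engine
counts PAIRS (friable solutions of `2^N q^v m' + b = c` with congruence conditions) by the circle method; this file is the
bridge from the key-cell vocabulary of `…KeyCellDefs.lean` (`intensity`, `cellMass`) to such counts — pure `Finset`
combinatorics (generic lemmas in the sub-namespace `FamilyCountsBook`):
* `card_mul_intensity_image`: for an injective parametrisation `F = S.image f`, `#F · intensity F P q D` is the number
  of parameters `p ∈ S` whose triple `f p` carries the key `(q; D)` in position `P`;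
* `keyA_iff`, `keyB_iff`, `keyC_iff`: on a triple with `gcd(a, b) = 1`, `a + b = c`, for `v ≥ 1` the key event
  `q ∈ (member).primeFactors ∧ datum a b c q = mkDatum (P.exps v) r s z` unfolds to
  `v_q(member) = v ∧ (a-, b-, c-residue) = (r, s, z)`, the member's residue being that of its `q`-free part `member/q^v`,
  a partner's that of itself: the partner valuations VANISH AUTOMATICALLY (a prime factor of one member of a coprime
  triple divides no other), so they are dropped, and `n / q^0 % q = n % q`;
* `sum_box_card_filter`: summing such counts over the residue box `(range q)³` counts the parameters with
  `v_q(member) = v` (`Finset.card_eq_sum_card_fiberwise`, one coordinate at a time) — whence the `cellMass` versions;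
* swap rules for `FBfam` (`intensity_FBfam`): the datum of `(b, a, c)` at `q` is `(v_q b, v_q a, v_q c; b', a', c')`, so
  the position-`A` key `(v,0,0; r,s,z)` of the swapped triple is the position-`B` key `(0,v,0; s,r,z)` of the original.
Family statements: `stub_familyPairsA` (registered, verbatim) `= familyPairsA_A`, `familyPairsA_B/C`, `familyCellA_A/B/C`,
`card_FAfam`; `familyPairsC_A/B/C`, `familyCellC_A/B/C`, `card_FCfam`; `intensity_FBfam_A/B/C`, `cellMass_FBfam_A/B/C`,
`card_FBfam`.  Conjunct order in every pair count: `v_q(member) = v ∧ a-residue = r ∧ b-residue = s ∧ c-residue = z`.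
-/

-- `Summit.<Summit>.<Problem>` is the mandated summit-side namespace (CONVENTIONS §2); for the
-- single-conjunct summit `ABC` the two coincide, so the duplicate `ABC.ABC` is deliberate.
set_option linter.dupNamespace false

noncomputable section

namespace Summit.ABC.ABC.Theorems.TameLocalReceptacle

open Finset

namespace FamilyCountsBook

/-! ### Generic counting lemmas -/

/-- For an injectively parametrised family `F = S.image f`, `#F · intensity F P q D` is the number of parameters whose
triple carries the key `(q; D)` in position `P`, for any pointwise-equivalent rewriting `pr` of the key event
(`#F · (Σ/#F) = Σ`, also when `F = ∅`). [folklore] -/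
theorem card_mul_intensity_image {α : Type*} (S : Finset α) {f : α → ℕ × ℕ × ℕ} (hf : Set.InjOn f S) (P : Pos)
    (q : ℕ) (D : ℕ × ℕ × ℕ × ℕ × ℕ × ℕ) (pr : α → Prop) [DecidablePred pr]
    (h : ∀ p ∈ S, (q ∈ (P.sel (f p)).primeFactors ∧ datum (f p).1 (f p).2.1 (f p).2.2 q = D) ↔ pr p) :
    ((S.image f).card : ℝ) * intensity (S.image f) P q D = ((S.filter pr).card : ℝ) := by
  unfold intensity mean
  rw [Finset.card_image_of_injOn hf, Finset.sum_image hf,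
    Finset.sum_congr rfl fun p hp => if_congr (h p hp) rfl rfl, Finset.sum_boole]
  rcases eq_or_ne S.card 0 with h0 | h0
  · simp [Finset.card_eq_zero.1 h0]
  · exact mul_div_cancel₀ _ (Nat.cast_ne_zero.2 h0)

/-- Fibring a count over one residue coordinate `g` with values `< q`. [folklore] -/
theorem card_filter_eq_sum_range {α : Type*} (S : Finset α) (pr : α → Prop) [DecidablePred pr] (g : α → ℕ)
    {q : ℕ} (hg : ∀ p ∈ S, g p < q) :
    (S.filter pr).card = ∑ r ∈ range q, (S.filter (fun p => pr p ∧ g p = r)).card := by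
  rw [Finset.card_eq_sum_card_fiberwise (f := g) (t := range q) fun p hp =>
    Finset.mem_coe.2 (Finset.mem_range.2 (hg p (Finset.mem_of_mem_filter p (Finset.mem_coe.1 hp))))]
  simp only [Finset.filter_filter]

/-- Fibring a count over the residue box `(range q)³`: the sum over `(r, s, z)` of the number of parameters satisfying
`pr` with residues `(g₁, g₂, g₃) = (r, s, z)` is the number of parameters satisfying `pr`. [folklore] -/
theorem sum_box_card_filter {α : Type*} (S : Finset α) (pr : α → Prop) [DecidablePred pr] (g₁ g₂ g₃ : α → ℕ)
    {q : ℕ} (h₁ : ∀ p ∈ S, g₁ p < q) (h₂ : ∀ p ∈ S, g₂ p < q) (h₃ : ∀ p ∈ S, g₃ p < q) :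
    ∑ r ∈ range q, ∑ s ∈ range q, ∑ z ∈ range q,
        ((S.filter (fun p => pr p ∧ g₁ p = r ∧ g₂ p = s ∧ g₃ p = z)).card : ℝ) = ((S.filter pr).card : ℝ) := by
  rw [card_filter_eq_sum_range S pr g₁ h₁, Nat.cast_sum]
  refine Finset.sum_congr rfl fun r _ => ?_
  rw [card_filter_eq_sum_range S _ g₂ h₂, Nat.cast_sum]
  refine Finset.sum_congr rfl fun s _ => ?_
  rw [card_filter_eq_sum_range S _ g₃ h₃, Nat.cast_sum]
  refine Finset.sum_congr rfl fun z _ => ?_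
  exact congrArg _ (congrArg Finset.card (Finset.filter_congr fun p _ => (and_assoc.trans and_assoc).symm))

/-! ### The key event on a coprime triple `a + b = c` -/

/-- A prime factor of `a` is not a factor of a number coprime to `a`. [folklore] -/
theorem factorization_eq_zero_of_coprime {a b q : ℕ} (hab : Nat.Coprime a b) (hq : q ∈ a.primeFactors) :
    b.factorization q = 0 :=
  Finsupp.notMem_support_iff.1 (Finset.disjoint_left.1 hab.disjoint_primeFactors hq)

/-- `v_q(a) = v ≥ 1` forces `q ∈ a.primeFactors`. [folklore] -/
theorem mem_primeFactors_of_factorization_eq {a q v : ℕ} (hv : 1 ≤ v) (ha : a.factorization q = v) :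
    q ∈ a.primeFactors := by
  rw [← Nat.support_factorization, Finsupp.mem_support_iff]
  omega

/-- KEY EVENT, position `A`: on a triple with `gcd(a, b) = 1`, `a + b = c`, for `v ≥ 1`,
`q ∈ a.primeFactors ∧ datum a b c q = (v,0,0; r,s,z)` iff `v_q(a) = v ∧ a/q^v % q = r ∧ b % q = s ∧ c % q = z`
(`v_q(b) = v_q(c) = 0` being automatic). [folklore] -/
theorem keyA_iff {a b c q v r s z : ℕ} (hv : 1 ≤ v) (hab : Nat.Coprime a b) (habc : a + b = c) :
    (q ∈ a.primeFactors ∧ datum a b c q = mkDatum (Pos.exps Pos.A v) r s z) ↔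
      (a.factorization q = v ∧ a / q ^ v % q = r ∧ b % q = s ∧ c % q = z) := by
  have hac : Nat.Coprime a c := habc ▸ Nat.coprime_self_add_right.mpr hab
  simp only [datum, mkDatum, Pos.exps, Prod.mk.injEq]
  refine ⟨fun ⟨_, hva, hvb, hvc, hr, hs, hz⟩ => ?_, fun ⟨hva, hr, hs, hz⟩ => ?_⟩
  · simp only [hva, hvb, hvc, pow_zero, Nat.div_one] at hr hs hz
    exact ⟨hva, hr, hs, hz⟩
  · have hq := mem_primeFactors_of_factorization_eq hv hva
    have hvb := factorization_eq_zero_of_coprime hab hq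
    have hvc := factorization_eq_zero_of_coprime hac hq
    refine ⟨hq, hva, hvb, hvc, ?_, ?_, ?_⟩ <;> simpa only [hva, hvb, hvc, pow_zero, Nat.div_one]

/-- KEY EVENT, position `B`: `q ∈ b.primeFactors ∧ datum a b c q = (0,v,0; r,s,z)` iff
`v_q(b) = v ∧ a % q = r ∧ b/q^v % q = s ∧ c % q = z`. [folklore] -/
theorem keyB_iff {a b c q v r s z : ℕ} (hv : 1 ≤ v) (hab : Nat.Coprime a b) (habc : a + b = c) :
    (q ∈ b.primeFactors ∧ datum a b c q = mkDatum (Pos.exps Pos.B v) r s z) ↔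
      (b.factorization q = v ∧ a % q = r ∧ b / q ^ v % q = s ∧ c % q = z) := by
  have hbc : Nat.Coprime b c := habc ▸ Nat.coprime_add_self_right.mpr hab.symm
  simp only [datum, mkDatum, Pos.exps, Prod.mk.injEq]
  refine ⟨fun ⟨_, hva, hvb, hvc, hr, hs, hz⟩ => ?_, fun ⟨hvb, hr, hs, hz⟩ => ?_⟩
  · simp only [hva, hvb, hvc, pow_zero, Nat.div_one] at hr hs hz
    exact ⟨hvb, hr, hs, hz⟩
  · have hq := mem_primeFactors_of_factorization_eq hv hvb
    have hva := factorization_eq_zero_of_coprime hab.symm hq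
    have hvc := factorization_eq_zero_of_coprime hbc hq
    refine ⟨hq, hva, hvb, hvc, ?_, ?_, ?_⟩ <;> simpa only [hva, hvb, hvc, pow_zero, Nat.div_one]

/-- KEY EVENT, position `C`: `q ∈ c.primeFactors ∧ datum a b c q = (0,0,v; r,s,z)` iff
`v_q(c) = v ∧ a % q = r ∧ b % q = s ∧ c/q^v % q = z`. [folklore] -/
theorem keyC_iff {a b c q v r s z : ℕ} (hv : 1 ≤ v) (hab : Nat.Coprime a b) (habc : a + b = c) :
    (q ∈ c.primeFactors ∧ datum a b c q = mkDatum (Pos.exps Pos.C v) r s z) ↔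
      (c.factorization q = v ∧ a % q = r ∧ b % q = s ∧ c / q ^ v % q = z) := by
  have hac : Nat.Coprime a c := habc ▸ Nat.coprime_self_add_right.mpr hab
  have hbc : Nat.Coprime b c := habc ▸ Nat.coprime_add_self_right.mpr hab.symm
  simp only [datum, mkDatum, Pos.exps, Prod.mk.injEq]
  refine ⟨fun ⟨_, hva, hvb, hvc, hr, hs, hz⟩ => ?_, fun ⟨hvc, hr, hs, hz⟩ => ?_⟩
  · simp only [hva, hvb, hvc, pow_zero, Nat.div_one] at hr hs hz
    exact ⟨hvc, hr, hs, hz⟩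
  · have hq := mem_primeFactors_of_factorization_eq hv hvc
    have hva := factorization_eq_zero_of_coprime hac.symm hq
    have hvb := factorization_eq_zero_of_coprime hbc.symm hq
    refine ⟨hq, hva, hvb, hvc, ?_, ?_, ?_⟩ <;> simpa only [hva, hvb, hvc, pow_zero, Nat.div_one]

/-- The swap `(a, b, c) ↦ (b, a, c)` is injective. [folklore] -/
theorem swapBAC_injective : Function.Injective (fun T : ℕ × ℕ × ℕ => (T.2.1, T.1, T.2.2)) := by
  rintro ⟨a, b, c⟩ ⟨a', b', c'⟩ h
  simp only [Prod.mk.injEq] at h ⊢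
  exact ⟨h.2.1, h.1, h.2.2⟩

/-- The parametrisation `(m, b) ↦ (2^N m, b, 2^N m + b)` of `FAfam N M y` is injective. [folklore] -/
theorem mapA_injective (N : ℕ) :
    Function.Injective (fun p : ℕ × ℕ => (2 ^ N * p.1, p.2, 2 ^ N * p.1 + p.2)) := by
  rintro ⟨m, b⟩ ⟨m', b'⟩ h
  simp only [Prod.mk.injEq] at h
  rw [Nat.eq_of_mul_eq_mul_left (Nat.two_pow_pos N) h.1, h.2.1]

/-- On a parameter pair `(m, b)` of `FAfam N M y`, `gcd(2^N m, b) = 1` (from `gcd(b, 2m) = 1`). [folklore] -/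
theorem coprime_of_mem_pairsA {N M y : ℕ} {p : ℕ × ℕ}
    (hp : p ∈ (((friableIoc y M (2 * M)).filter (fun m => Odd m)) ×ˢ friableIoc y (2 ^ N * M) (2 * (2 ^ N * M))).filter
      (fun p => Nat.Coprime p.2 (2 * p.1) ∧ 2 ^ N * p.1 + p.2 ∈ Nat.smoothNumbers (y + 1))) :
    Nat.Coprime (2 ^ N * p.1) p.2 := by
  obtain ⟨h2, hm⟩ := Nat.coprime_mul_iff_right.1 (Finset.mem_filter.1 hp).2.1
  exact Nat.Coprime.mul_left (Nat.Coprime.pow_left N h2.symm) hm.symm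

/-- The parametrisation `(m, a) ↦ (a, 2^N m − a, 2^N m)` of `FCfam N M y` is injective. [folklore] -/
theorem mapC_injective (N : ℕ) :
    Function.Injective (fun p : ℕ × ℕ => (p.2, 2 ^ N * p.1 - p.2, 2 ^ N * p.1)) := by
  rintro ⟨m, a⟩ ⟨m', a'⟩ h
  simp only [Prod.mk.injEq] at h
  rw [Nat.eq_of_mul_eq_mul_left (Nat.two_pow_pos N) h.2.2, h.1]

/-- On a parameter pair `(m, a)` of `FCfam N M y`: `gcd(a, 2^N m − a) = 1` and `a + (2^N m − a) = 2^N m`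
(`a ≤ 3X/2 ≤ 2X < 2^N m`, `X = 2^N M`). [folklore] -/
theorem abc_of_mem_pairsC {N M y : ℕ} {p : ℕ × ℕ}
    (hp : p ∈ (((friableIoc y (2 * M) (4 * M)).filter (fun m => Odd m)) ×ˢ friableIoc y (2 ^ N * M) (3 * (2 ^ N * M) / 2)).filter
      (fun p => Nat.Coprime p.2 (2 * p.1) ∧ 2 ^ N * p.1 - p.2 ∈ Nat.smoothNumbers (y + 1))) :
    Nat.Coprime p.2 (2 ^ N * p.1 - p.2) ∧ p.2 + (2 ^ N * p.1 - p.2) = 2 ^ N * p.1 := by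
  simp only [friableIoc, Finset.mem_filter, Finset.mem_product, Finset.mem_Ioc, and_assoc] at hp
  obtain ⟨hMm, -, -, -, -, ha3, -, hcop, -⟩ := hp
  have h1 : 2 * (2 ^ N * M) < 2 ^ N * p.1 :=
    calc 2 * (2 ^ N * M) = 2 ^ N * (2 * M) := by ring
      _ < 2 ^ N * p.1 := Nat.mul_lt_mul_of_pos_left hMm (Nat.two_pow_pos N)
  have hle : p.2 ≤ 2 ^ N * p.1 := by omega
  obtain ⟨ha2, ham⟩ := Nat.coprime_mul_iff_right.1 hcop
  exact ⟨(Nat.coprime_sub_self_right hle).2 (Nat.Coprime.mul_right (Nat.Coprime.pow_right N ha2) ham),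
    Nat.add_sub_of_le hle⟩

end FamilyCountsBook

open FamilyCountsBook

/-! ### The family `FA`: key-cell intensities, cell masses and size as pair counts -/

/-- `#FA · intensity FA A q (v,0,0; r,s,z)` (`v ≥ 1`) is the number of pairs `(m, b)` with `v_q(2^N m) = v`,
`(2^N m / q^v, b, 2^N m + b) ≡ (r, s, z) (mod q)`. [folklore] -/
theorem familyPairsA_A {v : ℕ} (hv : 1 ≤ v) (N M y q r s z : ℕ) :
    ((FAfam N M y).card : ℝ) * intensity (FAfam N M y) Pos.A q (mkDatum (Pos.exps Pos.A v) r s z) =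
      (((((friableIoc y M (2 * M)).filter (fun m => Odd m)) ×ˢ friableIoc y (2 ^ N * M) (2 * (2 ^ N * M))).filter (fun p => Nat.Coprime p.2 (2 * p.1) ∧ 2 ^ N * p.1 + p.2 ∈ Nat.smoothNumbers (y + 1))).filter
        (fun p => (2 ^ N * p.1).factorization q = v ∧ (2 ^ N * p.1) / q ^ v % q = r ∧ p.2 % q = s ∧ (2 ^ N * p.1 + p.2) % q = z)).card := by
  unfold FAfam
  refine card_mul_intensity_image _ (mapA_injective N).injOn Pos.A q _ _ fun p hp => ?_
  exact keyA_iff hv (coprime_of_mem_pairsA hp) rfl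

/-- **Registered stub `stub_familyPairsA`** (helper stub of wave 5 "FamilyCounts", line `grh-friable-cell-resolution` of
crux stmt-ABC-14354): `#FAfam` times the position-`A` key-cell intensity of `FAfam N M y` at `(q; v; r, s, z)`, `v ≥ 1`, is
the number of pairs `(m, b)` with `v_q(2^N m) = v`, `(2^N m / q^v, b, 2^N m + b) ≡ (r, s, z) (mod q)` — `familyPairsA_A`
(primality and oddness of `q` are not needed). [folklore] -/
theorem stub_familyPairsA : ∀ (N M y q v r s z : ℕ), q.Prime → q ≠ 2 → 1 ≤ v →
    ((FAfam N M y).card : ℝ) * intensity (FAfam N M y) Pos.A q (mkDatum (Pos.exps Pos.A v) r s z) =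
      (((((friableIoc y M (2 * M)).filter (fun m => Odd m)) ×ˢ friableIoc y (2 ^ N * M) (2 * (2 ^ N * M))).filter
        (fun p => Nat.Coprime p.2 (2 * p.1) ∧ 2 ^ N * p.1 + p.2 ∈ Nat.smoothNumbers (y + 1))).filter
        (fun p => (2 ^ N * p.1).factorization q = v ∧ (2 ^ N * p.1) / q ^ v % q = r ∧ p.2 % q = s ∧
          (2 ^ N * p.1 + p.2) % q = z)).card :=
  fun N M y q _ r s z _ _ hv => familyPairsA_A hv N M y q r s z

/-- Position `B` of `FA`: `#FA · intensity FA B q (0,v,0; r,s,z)` (`v ≥ 1`) is the number of pairs `(m, b)` with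
`v_q(b) = v`, `(2^N m, b / q^v, 2^N m + b) ≡ (r, s, z) (mod q)`. [folklore] -/
theorem familyPairsA_B {v : ℕ} (hv : 1 ≤ v) (N M y q r s z : ℕ) :
    ((FAfam N M y).card : ℝ) * intensity (FAfam N M y) Pos.B q (mkDatum (Pos.exps Pos.B v) r s z) =
      (((((friableIoc y M (2 * M)).filter (fun m => Odd m)) ×ˢ friableIoc y (2 ^ N * M) (2 * (2 ^ N * M))).filter (fun p => Nat.Coprime p.2 (2 * p.1) ∧ 2 ^ N * p.1 + p.2 ∈ Nat.smoothNumbers (y + 1))).filter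
        (fun p => p.2.factorization q = v ∧ (2 ^ N * p.1) % q = r ∧ p.2 / q ^ v % q = s ∧ (2 ^ N * p.1 + p.2) % q = z)).card := by
  unfold FAfam
  refine card_mul_intensity_image _ (mapA_injective N).injOn Pos.B q _ _ fun p hp => ?_
  exact keyB_iff hv (coprime_of_mem_pairsA hp) rfl

/-- Position `C` of `FA`: `#FA · intensity FA C q (0,0,v; r,s,z)` (`v ≥ 1`) is the number of pairs `(m, b)` with
`v_q(2^N m + b) = v`, `(2^N m, b, (2^N m + b) / q^v) ≡ (r, s, z) (mod q)`. [folklore] -/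
theorem familyPairsA_C {v : ℕ} (hv : 1 ≤ v) (N M y q r s z : ℕ) :
    ((FAfam N M y).card : ℝ) * intensity (FAfam N M y) Pos.C q (mkDatum (Pos.exps Pos.C v) r s z) =
      (((((friableIoc y M (2 * M)).filter (fun m => Odd m)) ×ˢ friableIoc y (2 ^ N * M) (2 * (2 ^ N * M))).filter (fun p => Nat.Coprime p.2 (2 * p.1) ∧ 2 ^ N * p.1 + p.2 ∈ Nat.smoothNumbers (y + 1))).filter
        (fun p => (2 ^ N * p.1 + p.2).factorization q = v ∧ (2 ^ N * p.1) % q = r ∧ p.2 % q = s ∧ (2 ^ N * p.1 + p.2) / q ^ v % q = z)).card := by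
  unfold FAfam
  refine card_mul_intensity_image _ (mapA_injective N).injOn Pos.C q _ _ fun p hp => ?_
  exact keyC_iff hv (coprime_of_mem_pairsA hp) rfl

/-- Cell mass of `FA`, position `A`: `#FA · cellMass FA A q v` (`q` prime, `v ≥ 1`) is the number of pairs `(m, b)`
with `v_q(2^N m) = v`. [folklore] -/
theorem familyCellA_A {q v : ℕ} (hq : q.Prime) (hv : 1 ≤ v) (N M y : ℕ) :
    ((FAfam N M y).card : ℝ) * cellMass (FAfam N M y) Pos.A q v =
      (((((friableIoc y M (2 * M)).filter (fun m => Odd m)) ×ˢ friableIoc y (2 ^ N * M) (2 * (2 ^ N * M))).filter (fun p => Nat.Coprime p.2 (2 * p.1) ∧ 2 ^ N * p.1 + p.2 ∈ Nat.smoothNumbers (y + 1))).filter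
        (fun p => (2 ^ N * p.1).factorization q = v)).card := by
  simp only [cellMass, Finset.mul_sum, familyPairsA_A hv]
  exact sum_box_card_filter _ (fun p : ℕ × ℕ => (2 ^ N * p.1).factorization q = v) (fun p => 2 ^ N * p.1 / q ^ v % q)
    (fun p => p.2 % q) (fun p => (2 ^ N * p.1 + p.2) % q) (fun _ _ => Nat.mod_lt _ hq.pos)
    (fun _ _ => Nat.mod_lt _ hq.pos) fun _ _ => Nat.mod_lt _ hq.pos

/-- Cell mass of `FA`, position `B`: `#FA · cellMass FA B q v` is the number of pairs with `v_q(b) = v`. [folklore] -/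
theorem familyCellA_B {q v : ℕ} (hq : q.Prime) (hv : 1 ≤ v) (N M y : ℕ) :
    ((FAfam N M y).card : ℝ) * cellMass (FAfam N M y) Pos.B q v =
      (((((friableIoc y M (2 * M)).filter (fun m => Odd m)) ×ˢ friableIoc y (2 ^ N * M) (2 * (2 ^ N * M))).filter (fun p => Nat.Coprime p.2 (2 * p.1) ∧ 2 ^ N * p.1 + p.2 ∈ Nat.smoothNumbers (y + 1))).filter
        (fun p => p.2.factorization q = v)).card := by
  simp only [cellMass, Finset.mul_sum, familyPairsA_B hv]
  exact sum_box_card_filter _ (fun p : ℕ × ℕ => p.2.factorization q = v) (fun p => 2 ^ N * p.1 % q)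
    (fun p => p.2 / q ^ v % q) (fun p => (2 ^ N * p.1 + p.2) % q) (fun _ _ => Nat.mod_lt _ hq.pos)
    (fun _ _ => Nat.mod_lt _ hq.pos) fun _ _ => Nat.mod_lt _ hq.pos

/-- Cell mass of `FA`, position `C`: `#FA · cellMass FA C q v` is the number of pairs with `v_q(2^N m + b) = v`.
[folklore] -/
theorem familyCellA_C {q v : ℕ} (hq : q.Prime) (hv : 1 ≤ v) (N M y : ℕ) :
    ((FAfam N M y).card : ℝ) * cellMass (FAfam N M y) Pos.C q v =
      (((((friableIoc y M (2 * M)).filter (fun m => Odd m)) ×ˢ friableIoc y (2 ^ N * M) (2 * (2 ^ N * M))).filter (fun p => Nat.Coprime p.2 (2 * p.1) ∧ 2 ^ N * p.1 + p.2 ∈ Nat.smoothNumbers (y + 1))).filter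
        (fun p => (2 ^ N * p.1 + p.2).factorization q = v)).card := by
  simp only [cellMass, Finset.mul_sum, familyPairsA_C hv]
  exact sum_box_card_filter _ (fun p : ℕ × ℕ => (2 ^ N * p.1 + p.2).factorization q = v)
    (fun p => 2 ^ N * p.1 % q) (fun p => p.2 % q) (fun p => (2 ^ N * p.1 + p.2) / q ^ v % q)
    (fun _ _ => Nat.mod_lt _ hq.pos) (fun _ _ => Nat.mod_lt _ hq.pos) fun _ _ => Nat.mod_lt _ hq.pos

/-- `#FAfam N M y` is the number of parameter pairs `(m, b)`. [folklore] -/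
theorem card_FAfam (N M y : ℕ) :
    (FAfam N M y).card = ((((friableIoc y M (2 * M)).filter (fun m => Odd m)) ×ˢ friableIoc y (2 ^ N * M) (2 * (2 ^ N * M))).filter
      (fun p => Nat.Coprime p.2 (2 * p.1) ∧ 2 ^ N * p.1 + p.2 ∈ Nat.smoothNumbers (y + 1))).card :=
  Finset.card_image_of_injective _ (mapA_injective N)

/-! ### The family `FC` -/

/-- Position `A` of `FC`: `#FC · intensity FC A q (v,0,0; r,s,z)` (`v ≥ 1`) is the number of pairs `(m, a)` with
`v_q(a) = v`, `(a / q^v, 2^N m − a, 2^N m) ≡ (r, s, z) (mod q)`. [folklore] -/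
theorem familyPairsC_A {v : ℕ} (hv : 1 ≤ v) (N M y q r s z : ℕ) :
    ((FCfam N M y).card : ℝ) * intensity (FCfam N M y) Pos.A q (mkDatum (Pos.exps Pos.A v) r s z) =
      (((((friableIoc y (2 * M) (4 * M)).filter (fun m => Odd m)) ×ˢ friableIoc y (2 ^ N * M) (3 * (2 ^ N * M) / 2)).filter (fun p => Nat.Coprime p.2 (2 * p.1) ∧ 2 ^ N * p.1 - p.2 ∈ Nat.smoothNumbers (y + 1))).filter
        (fun p => p.2.factorization q = v ∧ p.2 / q ^ v % q = r ∧ (2 ^ N * p.1 - p.2) % q = s ∧ (2 ^ N * p.1) % q = z)).card := by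
  unfold FCfam
  refine card_mul_intensity_image _ (mapC_injective N).injOn Pos.A q _ _ fun p hp => ?_
  exact keyA_iff hv (abc_of_mem_pairsC hp).1 (abc_of_mem_pairsC hp).2

/-- Position `B` of `FC`: `#FC · intensity FC B q (0,v,0; r,s,z)` (`v ≥ 1`) is the number of pairs `(m, a)` with
`v_q(2^N m − a) = v`, `(a, (2^N m − a) / q^v, 2^N m) ≡ (r, s, z) (mod q)`. [folklore] -/
theorem familyPairsC_B {v : ℕ} (hv : 1 ≤ v) (N M y q r s z : ℕ) :
    ((FCfam N M y).card : ℝ) * intensity (FCfam N M y) Pos.B q (mkDatum (Pos.exps Pos.B v) r s z) =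
      (((((friableIoc y (2 * M) (4 * M)).filter (fun m => Odd m)) ×ˢ friableIoc y (2 ^ N * M) (3 * (2 ^ N * M) / 2)).filter (fun p => Nat.Coprime p.2 (2 * p.1) ∧ 2 ^ N * p.1 - p.2 ∈ Nat.smoothNumbers (y + 1))).filter
        (fun p => (2 ^ N * p.1 - p.2).factorization q = v ∧ p.2 % q = r ∧ (2 ^ N * p.1 - p.2) / q ^ v % q = s ∧ (2 ^ N * p.1) % q = z)).card := by
  unfold FCfam
  refine card_mul_intensity_image _ (mapC_injective N).injOn Pos.B q _ _ fun p hp => ?_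
  exact keyB_iff hv (abc_of_mem_pairsC hp).1 (abc_of_mem_pairsC hp).2

/-- Position `C` of `FC`: `#FC · intensity FC C q (0,0,v; r,s,z)` (`v ≥ 1`) is the number of pairs `(m, a)` with
`v_q(2^N m) = v`, `(a, 2^N m − a, 2^N m / q^v) ≡ (r, s, z) (mod q)`. [folklore] -/
theorem familyPairsC_C {v : ℕ} (hv : 1 ≤ v) (N M y q r s z : ℕ) :
    ((FCfam N M y).card : ℝ) * intensity (FCfam N M y) Pos.C q (mkDatum (Pos.exps Pos.C v) r s z) =
      (((((friableIoc y (2 * M) (4 * M)).filter (fun m => Odd m)) ×ˢ friableIoc y (2 ^ N * M) (3 * (2 ^ N * M) / 2)).filter (fun p => Nat.Coprime p.2 (2 * p.1) ∧ 2 ^ N * p.1 - p.2 ∈ Nat.smoothNumbers (y + 1))).filter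
        (fun p => (2 ^ N * p.1).factorization q = v ∧ p.2 % q = r ∧ (2 ^ N * p.1 - p.2) % q = s ∧ (2 ^ N * p.1) / q ^ v % q = z)).card := by
  unfold FCfam
  refine card_mul_intensity_image _ (mapC_injective N).injOn Pos.C q _ _ fun p hp => ?_
  exact keyC_iff hv (abc_of_mem_pairsC hp).1 (abc_of_mem_pairsC hp).2

/-- Cell mass of `FC`, position `A`: the number of pairs `(m, a)` with `v_q(a) = v` (`q` prime, `v ≥ 1`). [folklore] -/
theorem familyCellC_A {q v : ℕ} (hq : q.Prime) (hv : 1 ≤ v) (N M y : ℕ) :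
    ((FCfam N M y).card : ℝ) * cellMass (FCfam N M y) Pos.A q v =
      (((((friableIoc y (2 * M) (4 * M)).filter (fun m => Odd m)) ×ˢ friableIoc y (2 ^ N * M) (3 * (2 ^ N * M) / 2)).filter (fun p => Nat.Coprime p.2 (2 * p.1) ∧ 2 ^ N * p.1 - p.2 ∈ Nat.smoothNumbers (y + 1))).filter
        (fun p => p.2.factorization q = v)).card := by
  simp only [cellMass, Finset.mul_sum, familyPairsC_A hv]
  exact sum_box_card_filter _ (fun p : ℕ × ℕ => p.2.factorization q = v) (fun p => p.2 / q ^ v % q)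
    (fun p => (2 ^ N * p.1 - p.2) % q) (fun p => 2 ^ N * p.1 % q) (fun _ _ => Nat.mod_lt _ hq.pos)
    (fun _ _ => Nat.mod_lt _ hq.pos) fun _ _ => Nat.mod_lt _ hq.pos

/-- Cell mass of `FC`, position `B`: the number of pairs `(m, a)` with `v_q(2^N m − a) = v`. [folklore] -/
theorem familyCellC_B {q v : ℕ} (hq : q.Prime) (hv : 1 ≤ v) (N M y : ℕ) :
    ((FCfam N M y).card : ℝ) * cellMass (FCfam N M y) Pos.B q v =
      (((((friableIoc y (2 * M) (4 * M)).filter (fun m => Odd m)) ×ˢ friableIoc y (2 ^ N * M) (3 * (2 ^ N * M) / 2)).filter (fun p => Nat.Coprime p.2 (2 * p.1) ∧ 2 ^ N * p.1 - p.2 ∈ Nat.smoothNumbers (y + 1))).filter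
        (fun p => (2 ^ N * p.1 - p.2).factorization q = v)).card := by
  simp only [cellMass, Finset.mul_sum, familyPairsC_B hv]
  exact sum_box_card_filter _ (fun p : ℕ × ℕ => (2 ^ N * p.1 - p.2).factorization q = v) (fun p => p.2 % q)
    (fun p => (2 ^ N * p.1 - p.2) / q ^ v % q) (fun p => 2 ^ N * p.1 % q) (fun _ _ => Nat.mod_lt _ hq.pos)
    (fun _ _ => Nat.mod_lt _ hq.pos) fun _ _ => Nat.mod_lt _ hq.pos

/-- Cell mass of `FC`, position `C`: the number of pairs `(m, a)` with `v_q(2^N m) = v`. [folklore] -/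
theorem familyCellC_C {q v : ℕ} (hq : q.Prime) (hv : 1 ≤ v) (N M y : ℕ) :
    ((FCfam N M y).card : ℝ) * cellMass (FCfam N M y) Pos.C q v =
      (((((friableIoc y (2 * M) (4 * M)).filter (fun m => Odd m)) ×ˢ friableIoc y (2 ^ N * M) (3 * (2 ^ N * M) / 2)).filter (fun p => Nat.Coprime p.2 (2 * p.1) ∧ 2 ^ N * p.1 - p.2 ∈ Nat.smoothNumbers (y + 1))).filter
        (fun p => (2 ^ N * p.1).factorization q = v)).card := by
  simp only [cellMass, Finset.mul_sum, familyPairsC_C hv]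
  exact sum_box_card_filter _ (fun p : ℕ × ℕ => (2 ^ N * p.1).factorization q = v) (fun p => p.2 % q)
    (fun p => (2 ^ N * p.1 - p.2) % q) (fun p => 2 ^ N * p.1 / q ^ v % q) (fun _ _ => Nat.mod_lt _ hq.pos)
    (fun _ _ => Nat.mod_lt _ hq.pos) fun _ _ => Nat.mod_lt _ hq.pos

/-- `#FCfam N M y` is the number of parameter pairs `(m, a)`. [folklore] -/
theorem card_FCfam (N M y : ℕ) :
    (FCfam N M y).card = ((((friableIoc y (2 * M) (4 * M)).filter (fun m => Odd m)) ×ˢ friableIoc y (2 ^ N * M) (3 * (2 ^ N * M) / 2)).filter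
      (fun p => Nat.Coprime p.2 (2 * p.1) ∧ 2 ^ N * p.1 - p.2 ∈ Nat.smoothNumbers (y + 1))).card :=
  Finset.card_image_of_injective _ (mapC_injective N)

/-! ### The family `FB` (swap image of `FA`) -/

/-- Swap rule: a key event on `FBfam` is the key event on `FAfam` obtained by reading the triple as `(b, a, c)`. [folklore] -/
theorem intensity_FBfam (N M y q : ℕ) {P P' : Pos} {D D' : ℕ × ℕ × ℕ × ℕ × ℕ × ℕ}
    (h : ∀ T : ℕ × ℕ × ℕ, (q ∈ (P.sel (T.2.1, T.1, T.2.2)).primeFactors ∧ datum T.2.1 T.1 T.2.2 q = D) ↔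
      (q ∈ (P'.sel T).primeFactors ∧ datum T.1 T.2.1 T.2.2 q = D')) :
    intensity (FBfam N M y) P q D = intensity (FAfam N M y) P' q D' := by
  unfold FBfam intensity mean
  rw [Finset.sum_image swapBAC_injective.injOn, Finset.card_image_of_injective _ swapBAC_injective]
  exact congrArg (· / _) (Finset.sum_congr rfl fun T _ => if_congr (h T) rfl rfl)

/-- Swap rule, position `A`: `intensity FB A q (v,0,0; r,s,z) = intensity FA B q (0,v,0; s,r,z)`. [folklore] -/
theorem intensity_FBfam_A (N M y q v r s z : ℕ) :
    intensity (FBfam N M y) Pos.A q (mkDatum (Pos.exps Pos.A v) r s z) =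
      intensity (FAfam N M y) Pos.B q (mkDatum (Pos.exps Pos.B v) s r z) :=
  intensity_FBfam N M y q fun T => by
    simp only [Pos.sel, datum, mkDatum, Pos.exps, Prod.mk.injEq]
    constructor <;> rintro ⟨h0, h1, h2, h3, h4, h5, h6⟩ <;> exact ⟨h0, h2, h1, h3, h5, h4, h6⟩

/-- Swap rule, position `B`: `intensity FB B q (0,v,0; r,s,z) = intensity FA A q (v,0,0; s,r,z)`. [folklore] -/
theorem intensity_FBfam_B (N M y q v r s z : ℕ) :
    intensity (FBfam N M y) Pos.B q (mkDatum (Pos.exps Pos.B v) r s z) =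
      intensity (FAfam N M y) Pos.A q (mkDatum (Pos.exps Pos.A v) s r z) :=
  intensity_FBfam N M y q fun T => by
    simp only [Pos.sel, datum, mkDatum, Pos.exps, Prod.mk.injEq]
    constructor <;> rintro ⟨h0, h1, h2, h3, h4, h5, h6⟩ <;> exact ⟨h0, h2, h1, h3, h5, h4, h6⟩

/-- Swap rule, position `C`: `intensity FB C q (0,0,v; r,s,z) = intensity FA C q (0,0,v; s,r,z)`. [folklore] -/
theorem intensity_FBfam_C (N M y q v r s z : ℕ) :
    intensity (FBfam N M y) Pos.C q (mkDatum (Pos.exps Pos.C v) r s z) =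
      intensity (FAfam N M y) Pos.C q (mkDatum (Pos.exps Pos.C v) s r z) :=
  intensity_FBfam N M y q fun T => by
    simp only [Pos.sel, datum, mkDatum, Pos.exps, Prod.mk.injEq]
    constructor <;> rintro ⟨h0, h1, h2, h3, h4, h5, h6⟩ <;> exact ⟨h0, h2, h1, h3, h5, h4, h6⟩

/-- `cellMass FB A q v = cellMass FA B q v`. [folklore] -/
theorem cellMass_FBfam_A (N M y q v : ℕ) : cellMass (FBfam N M y) Pos.A q v = cellMass (FAfam N M y) Pos.B q v := by
  simp only [cellMass, intensity_FBfam_A]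
  exact Finset.sum_comm

/-- `cellMass FB B q v = cellMass FA A q v`. [folklore] -/
theorem cellMass_FBfam_B (N M y q v : ℕ) : cellMass (FBfam N M y) Pos.B q v = cellMass (FAfam N M y) Pos.A q v := by
  simp only [cellMass, intensity_FBfam_B]
  exact Finset.sum_comm

/-- `cellMass FB C q v = cellMass FA C q v`. [folklore] -/
theorem cellMass_FBfam_C (N M y q v : ℕ) : cellMass (FBfam N M y) Pos.C q v = cellMass (FAfam N M y) Pos.C q v := by
  simp only [cellMass, intensity_FBfam_C]
  exact Finset.sum_comm

/-- `#FBfam N M y = #FAfam N M y`. [folklore] -/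
theorem card_FBfam (N M y : ℕ) : (FBfam N M y).card = (FAfam N M y).card :=
  Finset.card_image_of_injective _ swapBAC_injective

end Summit.ABC.ABC.Theorems.TameLocalReceptacle

end
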